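import Mathlib
import Summits.ValiantsHypothesis.ValiantsHypothesis.Theorems.NewtonUnitEquationsTwoProductsPeelShallow
/-! # Stub `stub_pinnedConverse` — crux `TwoProducts` (stmt-ValiantsHypothesis-5906), line `corner-log-linearization`
   The CONVERSE CERTIFICATE of the support-only normal form (pinned points are vertices).

   Setting: bivariate polynomials `u_i` (`i < k`), `v_j` (`j < m`) with every `v_j` of constant term `1`,
   a finite set of exponents `L`, and a weight `w` with both entries positive.  In the power series
   ring put `U = ∏ ↑u_i`, `Q = ∏ ↑v_j` (constant term `1`, hence `Q * Q⁻¹ = 1`) and `G = U * Q⁻¹`.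
   A support point `e ≠ 0`, `e ∉ L` of `G` is `L`-PINNED (for `w`) when every other nonzero support
   point `q` of `G` with `wt_w q ≤ wt_w e` lies in `L`.  Claim: such an `e` is a strict
   `w`-minimiser of the support of the POLYNOMIAL `D = ∏ u_i - p_L * ∏ v_j`, where
   `p_L = Σ_{q ∈ insert 0 L} monomial q (G_q)` is the truncation of `G` to `L ∪ {0}`.

   Proof: `↑D = U - ↑p_L * Q = Q * ρ` with `ρ = G - ↑p_L`; the coefficients of `ρ` vanish on
   `insert 0 L` and agree with those of `G` elsewhere, so `ρ_e = G_e ≠ 0` and, by pinning, `ρ_q = 0`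
   for every `q ≠ e` that is `w`-lighter than or equal to `e`.  EASY DIRECTION of "a unit series
   does not move a strict minimiser": in the Cauchy product `(Q * ρ)_q = Σ_{a+b=q} Q_a ρ_b` at such a
   `q` (or at `e`) every term with `a ≠ 0` has `b` strictly lighter than `q`, hence `ρ_b = 0`, so
   `(Q * ρ)_q = ρ_q`.  Transfer to `D` through `coeff_coe`. [folklore] -/
set_option linter.dupNamespace false -- single-conjunct summit: `ValiantsHypothesis.ValiantsHypothesis`
namespace Summit.ValiantsHypothesis.ValiantsHypothesis.Theorems.TwoProducts.PinnedConverse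
open scoped BigOperators
open Summit.ValiantsHypothesis.ValiantsHypothesis.Theorems.TwoProducts.DepthOne
open Summit.ValiantsHypothesis.ValiantsHypothesis.Theorems.TwoProducts.PeelShallow

/-- EASY DIRECTION (a unit series does not move the lowest point).  Let `Q` be a bivariate power
series with constant term `1`, `w` a weight with both entries positive, and `e` a strict
`w`-minimiser of the support of `ρ` (i.e. `ρ_e ≠ 0` and `ρ_q = 0` for every `q ≠ e` of weight `≤`
that of `e`).  Then `e` is a strict `w`-minimiser of the support of `Q * ρ`. [folklore] -/
theorem strictMin_mul {Q ρ : MvPowerSeries (Fin 2) ℂ} (hQ : MvPowerSeries.constantCoeff Q = 1)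
    (w : Fin 2 → ℤ) (hw0 : 0 < w 0) (hw1 : 0 < w 1) (e : Fin 2 →₀ ℕ)
    (hρe : MvPowerSeries.coeff e ρ ≠ 0)
    (hρ : ∀ q : Fin 2 →₀ ℕ, q ≠ e →
      w 0 * (q 0 : ℤ) + w 1 * (q 1 : ℤ) ≤ w 0 * (e 0 : ℤ) + w 1 * (e 1 : ℤ) →
        MvPowerSeries.coeff q ρ = 0) :
    MvPowerSeries.coeff e (Q * ρ) ≠ 0 ∧ ∀ q : Fin 2 →₀ ℕ, q ≠ e →
      w 0 * (q 0 : ℤ) + w 1 * (q 1 : ℤ) ≤ w 0 * (e 0 : ℤ) + w 1 * (e 1 : ℤ) →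
        MvPowerSeries.coeff q (Q * ρ) = 0 := by
  -- at every exponent `q` that is `w`-lighter than or equal to `e` only the term `Q_0 ρ_q` survives
  have key : ∀ q : Fin 2 →₀ ℕ,
      w 0 * (q 0 : ℤ) + w 1 * (q 1 : ℤ) ≤ w 0 * (e 0 : ℤ) + w 1 * (e 1 : ℤ) →
        MvPowerSeries.coeff q (Q * ρ) = MvPowerSeries.coeff q ρ := by
    intro q hle
    refine coeff_mul_eq_of_vanish hQ q fun a b hab ha => ?_
    have hwa := wt_pos w hw0 hw1 a ha
    have hsum := wt_add w a b
    rw [hab] at hsum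
    have hbe : b ≠ e := by
      rintro rfl
      linarith
    exact hρ b hbe (by linarith)
  refine ⟨?_, fun q hqe hle => ?_⟩
  · rw [key e le_rfl]
    exact hρe
  · rw [key q hle]
    exact hρ q hqe hle

/-- TRUNCATION.  Subtracting from a power series `G` the polynomial `Σ_{q ∈ S} monomial q (G_q)`
(its truncation to a finite set of exponents `S`) kills exactly the coefficients indexed by `S` and
keeps the others. [folklore] -/
theorem coeff_sub_trunc (G : MvPowerSeries (Fin 2) ℂ) (S : Finset (Fin 2 →₀ ℕ)) (q : Fin 2 →₀ ℕ) :
    MvPowerSeries.coeff q (G - ((∑ x ∈ S, MvPolynomial.monomial x (MvPowerSeries.coeff x G) :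
        MvPolynomial (Fin 2) ℂ) : MvPowerSeries (Fin 2) ℂ)) =
      if q ∈ S then 0 else MvPowerSeries.coeff q G := by
  classical
  rw [map_sub, MvPolynomial.coeff_coe, MvPolynomial.coeff_sum]
  simp only [MvPolynomial.coeff_monomial, Finset.sum_ite_eq']
  split_ifs <;> simp

/-- **Pinned points are vertices** (rung `stub_pinnedConverse`, registered signature).  With
`G = (∏ ↑u_i) * (∏ ↑v_j)⁻¹` (all `v_j` of constant term `1`), `w > 0`, and `e ≠ 0`, `e ∉ L` a
support point of `G` such that every other nonzero support point of `G` of `w`-weight at most that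
of `e` lies in `L`: then `e` is a strict `w`-minimiser of the support of
`∏ u_i - (Σ_{q ∈ insert 0 L} monomial q (G_q)) * ∏ v_j`. [folklore] -/
theorem stub_pinnedConverse : ∀ (k m : ℕ) (u : Fin k → MvPolynomial (Fin 2) ℂ)
    (v : Fin m → MvPolynomial (Fin 2) ℂ) (L : Finset (Fin 2 →₀ ℕ)),
    (∀ j, MvPolynomial.coeff 0 (v j) = 1) →
    ∀ (w : Fin 2 → ℤ), 0 < w 0 → 0 < w 1 → ∀ (e : Fin 2 →₀ ℕ), e ≠ 0 → e ∉ L →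
    MvPowerSeries.coeff e ((∏ i, ((u i : MvPolynomial (Fin 2) ℂ) : MvPowerSeries (Fin 2) ℂ)) *
          (∏ j, ((v j : MvPolynomial (Fin 2) ℂ) : MvPowerSeries (Fin 2) ℂ))⁻¹) ≠ 0 →
    (∀ q : Fin 2 →₀ ℕ, q ≠ 0 → q ≠ e →
      MvPowerSeries.coeff q ((∏ i, ((u i : MvPolynomial (Fin 2) ℂ) : MvPowerSeries (Fin 2) ℂ)) *
          (∏ j, ((v j : MvPolynomial (Fin 2) ℂ) : MvPowerSeries (Fin 2) ℂ))⁻¹) ≠ 0 →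
      w 0 * (q 0 : ℤ) + w 1 * (q 1 : ℤ) ≤ w 0 * (e 0 : ℤ) + w 1 * (e 1 : ℤ) → q ∈ L) →
    e ∈ ((∏ i, u i) - (∑ q ∈ insert 0 L, MvPolynomial.monomial q (MvPowerSeries.coeff q
            ((∏ i, ((u i : MvPolynomial (Fin 2) ℂ) : MvPowerSeries (Fin 2) ℂ)) *
              (∏ j, ((v j : MvPolynomial (Fin 2) ℂ) : MvPowerSeries (Fin 2) ℂ))⁻¹))) * ∏ j, v j).support ∧
      ∀ e' ∈ ((∏ i, u i) - (∑ q ∈ insert 0 L, MvPolynomial.monomial q (MvPowerSeries.coeff q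
            ((∏ i, ((u i : MvPolynomial (Fin 2) ℂ) : MvPowerSeries (Fin 2) ℂ)) *
              (∏ j, ((v j : MvPolynomial (Fin 2) ℂ) : MvPowerSeries (Fin 2) ℂ))⁻¹))) * ∏ j, v j).support,
        e' ≠ e → w 0 * (e 0 : ℤ) + w 1 * (e 1 : ℤ) < w 0 * (e' 0 : ℤ) + w 1 * (e' 1 : ℤ) := by
  intro k m u v L hv w hw0 hw1 e he0 heL hGe hpin
  classical
  set U : MvPowerSeries (Fin 2) ℂ :=
    ∏ i, ((u i : MvPolynomial (Fin 2) ℂ) : MvPowerSeries (Fin 2) ℂ) with hU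
  set Q : MvPowerSeries (Fin 2) ℂ :=
    ∏ j, ((v j : MvPolynomial (Fin 2) ℂ) : MvPowerSeries (Fin 2) ℂ) with hQdef
  set p : MvPolynomial (Fin 2) ℂ :=
    ∑ q ∈ insert 0 L, MvPolynomial.monomial q (MvPowerSeries.coeff q (U * Q⁻¹)) with hp
  set D : MvPolynomial (Fin 2) ℂ := (∏ i, u i) - p * ∏ j, v j with hD
  -- `Q` has constant term `1`, hence is cancelled by its inverse
  have hQ1 : MvPowerSeries.constantCoeff Q = 1 := by
    rw [hQdef, map_prod]
    refine Finset.prod_eq_one fun j _ => ?_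
    rw [← MvPowerSeries.coeff_zero_eq_constantCoeff_apply, MvPolynomial.coeff_coe]
    exact hv j
  have hQinv : Q * Q⁻¹ = 1 := MvPowerSeries.mul_inv_cancel Q (by rw [hQ1]; exact one_ne_zero)
  -- the factorisation `↑D = Q * (G - ↑p)`
  have hcoe : ((D : MvPolynomial (Fin 2) ℂ) : MvPowerSeries (Fin 2) ℂ) =
      U - ((p : MvPolynomial (Fin 2) ℂ) : MvPowerSeries (Fin 2) ℂ) * Q := by
    rw [hD, hU, hQdef, ← MvPolynomial.coeToMvPowerSeries.ringHom_apply, map_sub, map_mul, map_prod,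
      map_prod]
    rfl
  have hfac : ((D : MvPolynomial (Fin 2) ℂ) : MvPowerSeries (Fin 2) ℂ) =
      Q * (U * Q⁻¹ - ((p : MvPolynomial (Fin 2) ℂ) : MvPowerSeries (Fin 2) ℂ)) := by
    rw [hcoe]
    calc U - ((p : MvPolynomial (Fin 2) ℂ) : MvPowerSeries (Fin 2) ℂ) * Q
        = U * (Q * Q⁻¹) - ((p : MvPolynomial (Fin 2) ℂ) : MvPowerSeries (Fin 2) ℂ) * Q := by
          rw [hQinv, mul_one]
      _ = Q * (U * Q⁻¹ - ((p : MvPolynomial (Fin 2) ℂ) : MvPowerSeries (Fin 2) ℂ)) := by ring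
  -- the coefficients of `ρ = G - ↑p`: zero on `insert 0 L`, those of `G` elsewhere
  have hρ : ∀ q : Fin 2 →₀ ℕ,
      MvPowerSeries.coeff q (U * Q⁻¹ - ((p : MvPolynomial (Fin 2) ℂ) : MvPowerSeries (Fin 2) ℂ)) =
        if q ∈ insert 0 L then 0 else MvPowerSeries.coeff q (U * Q⁻¹) := fun q => by
    rw [hp]
    exact coeff_sub_trunc (U * Q⁻¹) (insert 0 L) q
  -- `e` is a strict `w`-minimiser of the support of `ρ`
  have hρe : MvPowerSeries.coeff e
      (U * Q⁻¹ - ((p : MvPolynomial (Fin 2) ℂ) : MvPowerSeries (Fin 2) ℂ)) ≠ 0 := by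
    rw [hρ e, if_neg (by simp [he0, heL])]
    exact hGe
  have hρmin : ∀ q : Fin 2 →₀ ℕ, q ≠ e →
      w 0 * (q 0 : ℤ) + w 1 * (q 1 : ℤ) ≤ w 0 * (e 0 : ℤ) + w 1 * (e 1 : ℤ) →
        MvPowerSeries.coeff q
          (U * Q⁻¹ - ((p : MvPolynomial (Fin 2) ℂ) : MvPowerSeries (Fin 2) ℂ)) = 0 := by
    intro q hqe hle
    rw [hρ q]
    split_ifs with hq
    · rfl
    · rw [Finset.mem_insert, not_or] at hq
      by_contra hGq
      exact hq.2 (hpin q hq.1 hqe hGq hle)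
  -- hence of the support of `↑D = Q * ρ`
  obtain ⟨hDe, hDmin⟩ := strictMin_mul hQ1 w hw0 hw1 e hρe hρmin
  refine ⟨?_, fun e' he' hne => ?_⟩
  · rw [MvPolynomial.mem_support_iff, ← MvPolynomial.coeff_coe, hfac]
    exact hDe
  · rw [MvPolynomial.mem_support_iff, ← MvPolynomial.coeff_coe, hfac] at he'
    by_contra hlt
    exact he' (hDmin e' hne (not_lt.mp hlt))

end Summit.ValiantsHypothesis.ValiantsHypothesis.Theorems.TwoProducts.PinnedConverse
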